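import Summits.QuantumFields.BalabanUV.Beta.GAN24.SawtoothSlotCalculus

/-!
# `BalabanUV.Beta.GAN24.LegPairSectorWardForm` — binder row G-an2-4 ∕ (CONV-C), row (C) at the levels `j ≥ 1`, CONTACT side; Part 14 of
# `GAN24/FourFaceGaugeSectors`: **THE LEG-PAIR SECTOR IN WARD-READY FORM** — the mirror of Part 9 (`BackgroundPairSectorWardForm`) with (slot direction, slot
# site) ↔ (fibre index, leg site): the pure-gauge sector `Sector_{23}(Y) = Σ_{r∈cell} Σ'_{u′xz} (dλ_α)_α(x)·(dλ_β)_β(z)·Y κ r κ′ u′ x z (inl α)(inl β)` of a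
# unit-covariant `LocStencil₂` table (the four-face weight on a field leg reads the leg's OWN fibre direction — p2's `T2RecChargeStepFourFace`: faces `x_α`, `z_β`
# for the legs `(inl α)`, `(inl β)`) EQUALS the block sawtooth summed over ONE CELL of second-leg sites against the PURE-GAUGE DIVERGENCE OF THE TABLE's SECOND
# LEG, the first leg keeping its sawtooth gradient and both background slots running over the lattice:
# `Sector_{23}(Y) = Σ_{z₀∈box N} (z₀)_β·Σ'_r Σ'_{u′} Σ'_x (dλ_α)_α(x)·Σ_γ (Y κ r κ′ u′ x (toSite z₀ − e_γ) (inl α)(inl γ) − Y κ r κ′ u′ x (toSite z₀) (inl α)(inl γ))`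

NOT IN PRINT; OUR BOOKKEEPING (G-an2-4 crux team (2), leaf prover `b2b-balaban-gan24-formalise-leaf-02`, gen 65; journal INTENT I-leaf02-g65-7).  WHY.  Of the live
pure-gauge sectors of the contact word (Part 2: background pair, leg pair, quadruple), Parts 9–13 value the background pair through an2's per-site `hS₂` law.  The
LEG pair wants the kernel-LEG letter (an2's OFFER `Beta/KernelLegPullback.mmRead_K3OfK_kernelLeg_coarseDiv`: the coarse divergence of a kernel leg of `e4OfKW`
is the fine block pure gauge on the field leg of `G_j∘Y`) — a statement about the DIVERGENCE OF A KERNEL LEG at one coarse site.  The sector carries the sawtooth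
gradient on both legs over the whole lattice; the pure gauge `dλ_β` pairs with a field leg `(z, γ)` through its fibre index (`(dλ_β)_γ = 0` unless `γ = β`, and
`(dλ_β)_β(z) = 1 − N·[z_β % N = N−1]` IS the sector's leg weight — Part 9's `saw_succ_sub`), so summation by parts on the innermost leg (Part 9's one-coordinate
Abel lemma with the fibre index in the role of the slot direction) produces the leg divergence against the PERIODIC sawtooth; a Fubini rotation of the slot
triple and Part 9's cell–slot exchange between the cell-summed first background slot and that leg then put the sawtooth on ONE CELL of leg sites with the finite
weight `(z₀)_β` — the shape a per-site kernel-leg letter consumes —, the remaining three variables running over the lattice with absolutely convergent sums.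

WHAT (generic `d`, `1 ≤ N`; `Y : Tab d` with `LocStencil₂ Y C δ`, `0 < δ`, ff block BLOCK-covariant (`N•ℤ^{d+1}` shifts — p2's `member_translate` shape; unit
covariance is the special case); [folklore] re-indexing, Fubini, summation by
parts; 0 `def`, 0 cited facts, 0 `def … : Prop`, 0 sorry):
* §1 `tsum3_rotate` (Fubini: `Σ'_{u′} Σ'_x Σ'_z G = Σ'_z Σ'_{u′} Σ'_x G` for an absolutely summable slot triple), `summable_triple_leg₂` (a `LocStencil₂` table is
  summable in (first bond, second bond, first leg) at fixed second leg — shear to a product majorant), `legDiv₂_translate`.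
* §2 **`tsum_sawGrad_leg₂_eq`** — summation by parts on the second leg: `Σ'_z (1 − N·[z_β % N = N−1])·K x z a (inl β) = Σ'_z λ(z_β)·Σ_γ (K x (z − e_γ) a (inl γ) − K x z a (inl γ))`.
* §3 **`sector23_eq_sum_saw_legDiv`** — THE WARD-READY FORM with Part 1's literal `S = {2,3}` sector on the left (directions `![κ, κ′, α, β]`, legs `(inl α, inl β)`).
HONEST FRAMING (cell contract, verbatim): «discharging `BetaPertH` makes Bałaban's UV stability UNCONDITIONAL — a real constructive-QFT result; it is NOT the
continuum limit and NOT the Clay problem.»  HONEST DEPENDENCY (verbatim): «continuum YM on T⁴ ⇐ BetaPertH ∧ nine spine estimates (0/9 proved); BetaPertH ⇐ (D1)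
∧ (D4) ∧ CAP+tail; G-an2-4 gates asym, D1 and NE2/3/4.»  Bookkeeping only: NO Ward content (no kernel-leg letter is used or asserted), NO estimate of Bałaban's;
discharges NOTHING of (C) ∕ (C)sym ∕ (Q-L) ∕ «T2Shape» ∕ «T2Drift» ∕ (hW, hWall); 0 wall binders; NEVER «G-an2-4 closed» as (CONV-C); NOT D1, NOT BetaPertH, NOT
continuum, NOT Clay.  2026-08-23.
-/

noncomputable section

open Finset
open scoped BigOperators
open Literature.MathematicalPhysics.QuantumFieldTheory
open Literature.MathematicalPhysics.QuantumFieldTheory.Balaban1983to89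
open Literature.MathematicalPhysics.QuantumFieldTheory.Balaban1983to89.Beta
open B12Sec2to5 (l1 l1_nonneg)
open B6BondElimination (unitVec unitVec_apply)
open ExpKernelCalculus (MKer BiLoc shiftK summable_exp_shift summable_exp_shift' l1_sub_symm)
open AffineAveraging (Site box toSite)
open OneStepResolventKernel (Fib)
open BalabanCompositeJets (LocStencil₂)
open Summit.QuantumFields.BalabanUV.Beta.GAN24.BiStencilZeroMode (Tab)
open Summit.QuantumFields.BalabanUV.Beta.GAN24.KernelLegCharges (summable_prod_of_biLoc)
open Summit.QuantumFields.BalabanUV.Beta.GAN24.TableDressingZeroMode (summable_triple)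
open Summit.QuantumFields.BalabanUV.Beta.GAN24.CoarseGaugeSourceResponse (summable_bdd_mul tsum_add_shift)
open Summit.QuantumFields.BalabanUV.Beta.GAN24.SawtoothSlotCalculus (tsum_sawGrad_mul_eq_tsum_saw_mul_div sum_box_tsum_exchange abs_saw_le abs_sawGrad_le
  emod_add_zsmul_apply toSite_emod_of_mem_box)

namespace Summit.QuantumFields.BalabanUV.Beta.GAN24.LegPairSectorWardForm

variable {d : ℕ} {N : ℕ}

/-! ## §1 Fubini rotation of the slot triple; summability at fixed second leg; covariance of the leg divergence -/

/-- [folklore] **FUBINI ROTATION**: for an absolutely summable slot triple, `Σ'_{u′} Σ'_x Σ'_z G u′ x z = Σ'_z Σ'_{u′} Σ'_x G u′ x z`. -/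
theorem tsum3_rotate {G : Site (d + 1) → Site (d + 1) → Site (d + 1) → ℝ}
    (hG : Summable fun p : Site (d + 1) × (Site (d + 1) × Site (d + 1)) => G p.1 p.2.1 p.2.2) :
    ∑' u' : Site (d + 1), ∑' x : Site (d + 1), ∑' z : Site (d + 1), G u' x z
      = ∑' z : Site (d + 1), ∑' u' : Site (d + 1), ∑' x : Site (d + 1), G u' x z := by
  set Gf : Site (d + 1) × (Site (d + 1) × Site (d + 1)) → ℝ := fun p => G p.1 p.2.1 p.2.2 with hGf
  let e : Site (d + 1) × (Site (d + 1) × Site (d + 1)) ≃ Site (d + 1) × (Site (d + 1) × Site (d + 1)) :=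
    ⟨fun q => (q.2.1, (q.2.2, q.1)), fun p => (p.2.2, (p.1, p.2.1)), fun _ => rfl, fun _ => rfl⟩
  have hH : Summable (Gf ∘ e) := e.summable_iff.mpr hG
  have eL : ∑' u' : Site (d + 1), ∑' x : Site (d + 1), ∑' z : Site (d + 1), G u' x z = ∑' p, Gf p := by
    rw [hG.tsum_prod]
    exact tsum_congr fun u' => ((hG.prod_factor u').tsum_prod).symm
  have eR : ∑' z : Site (d + 1), ∑' u' : Site (d + 1), ∑' x : Site (d + 1), G u' x z = ∑' q, (Gf ∘ e) q := by
    rw [hH.tsum_prod]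
    exact tsum_congr fun z => ((hH.prod_factor z).tsum_prod).symm
  rw [eL, eR]
  exact (e.tsum_eq Gf).symm

/-- [folklore] … and the rotated iterated sums are summable in the new outer variable: `z ↦ Σ'_{u′} Σ'_x G u′ x z` is summable. -/
theorem summable_rotate {G : Site (d + 1) → Site (d + 1) → Site (d + 1) → ℝ}
    (hG : Summable fun p : Site (d + 1) × (Site (d + 1) × Site (d + 1)) => G p.1 p.2.1 p.2.2) :
    Summable fun z : Site (d + 1) => ∑' u' : Site (d + 1), ∑' x : Site (d + 1), G u' x z := by
  set Gf : Site (d + 1) × (Site (d + 1) × Site (d + 1)) → ℝ := fun p => G p.1 p.2.1 p.2.2 with hGf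
  let e : Site (d + 1) × (Site (d + 1) × Site (d + 1)) ≃ Site (d + 1) × (Site (d + 1) × Site (d + 1)) :=
    ⟨fun q => (q.2.1, (q.2.2, q.1)), fun p => (p.2.2, (p.1, p.2.1)), fun _ => rfl, fun _ => rfl⟩
  have hH : Summable (Gf ∘ e) := e.summable_iff.mpr hG
  exact hH.prod.congr fun z => (hH.prod_factor z).tsum_prod

/-- [folklore] **A `LocStencil₂` TABLE IS ABSOLUTELY SUMMABLE IN (FIRST BOND, SECOND BOND, FIRST LEG) AT FIXED SECOND LEG** (rate `δ > 0`; dominated by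
`C·e^{−δ|u′−r|}·e^{−δ|x−r|}·e^{−δ|z₀−r|}`, a product after the shear `(r,u′,x) ↦ (r, u′−r, x−r)`). -/
theorem summable_triple_leg₂ {Y : Tab d} {C δ : ℝ} (hY : LocStencil₂ Y C δ) (hδ : 0 < δ) (κ κ' : Fin (d + 1)) (z₀ : Site (d + 1)) (a b : Fib d) :
    Summable fun p : Site (d + 1) × (Site (d + 1) × Site (d + 1)) => Y κ p.1 κ' p.2.1 p.2.2 z₀ a b := by
  have h1 : Summable fun r : Site (d + 1) => Real.exp (-δ * l1 (z₀ - r)) := summable_exp_shift hδ z₀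
  have h0 : Summable fun x : Site (d + 1) => Real.exp (-δ * l1 x) :=
    (summable_exp_shift' hδ (0 : Site (d + 1))).congr fun x => by rw [sub_zero]
  have h23 := h0.mul_of_nonneg h0 (fun _ => (Real.exp_pos _).le) (fun _ => (Real.exp_pos _).le)
  have hP := h1.mul_of_nonneg h23 (fun _ => (Real.exp_pos _).le) (fun _ => mul_nonneg (Real.exp_pos _).le (Real.exp_pos _).le)
  set e : Site (d + 1) × (Site (d + 1) × Site (d + 1)) → Site (d + 1) × (Site (d + 1) × Site (d + 1)) :=
    fun p => (p.1, (p.2.1 - p.1, p.2.2 - p.1)) with he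
  have hinj : Function.Injective e := by
    rintro ⟨u, x, z⟩ ⟨u₁, x₁, z₁⟩ h
    simp only [he, Prod.mk.injEq] at h
    obtain ⟨rfl, hx, hz⟩ := h
    rw [sub_left_inj] at hx hz
    rw [hx, hz]
  have hQ := hP.comp_injective hinj
  refine Summable.of_norm_bounded (hQ.mul_left C) fun p => ?_
  rw [Real.norm_eq_abs]
  calc |Y κ p.1 κ' p.2.1 p.2.2 z₀ a b|
      ≤ C * Real.exp (-δ * l1 (p.2.1 - p.1)) * Real.exp (-δ * (l1 (p.2.2 - p.1) + l1 (z₀ - p.1))) := hY κ p.1 κ' p.2.1 p.2.2 z₀ a b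
    _ = C * ((fun q : Site (d + 1) × (Site (d + 1) × Site (d + 1)) =>
          Real.exp (-δ * l1 (z₀ - q.1)) * (Real.exp (-δ * l1 q.2.1) * Real.exp (-δ * l1 q.2.2))) ∘ e) p := by
        simp only [Function.comp, he]; rw [mul_add, Real.exp_add]; ring

/-- [folklore] The pure-gauge divergence of the second leg is block-covariant with the table: under the BLOCK covariance `h1` (`N•ℤ^{d+1}` shifts),
`Σ_γ (Y κ (r+N•t) κ′ (u′+N•t) (x+N•t) (z+N•t−e_γ) (inl α)(inl γ) − …) = Σ_γ (Y κ r κ′ u′ x (z−e_γ) (inl α)(inl γ) − Y κ r κ′ u′ x z (inl α)(inl γ))`. -/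
theorem legDiv₂_translate {Y : Tab d}
    (h1 : ∀ κ u κ' u' (t x z : Site (d + 1)) (α β : Fin (d + 1)),
      Y κ (u + (N : ℤ) • t) κ' (u' + (N : ℤ) • t) x z (Sum.inl α) (Sum.inl β) = shiftK (-((N : ℤ) • t)) (Y κ u κ' u') x z (Sum.inl α) (Sum.inl β))
    (κ κ' : Fin (d + 1)) (r u' x z t : Site (d + 1)) (α : Fin (d + 1)) :
    ∑ γ : Fin (d + 1), (Y κ (r + (N : ℤ) • t) κ' (u' + (N : ℤ) • t) (x + (N : ℤ) • t) (z + (N : ℤ) • t - unitVec γ) (Sum.inl α) (Sum.inl γ)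
        - Y κ (r + (N : ℤ) • t) κ' (u' + (N : ℤ) • t) (x + (N : ℤ) • t) (z + (N : ℤ) • t) (Sum.inl α) (Sum.inl γ))
      = ∑ γ : Fin (d + 1), (Y κ r κ' u' x (z - unitVec γ) (Sum.inl α) (Sum.inl γ) - Y κ r κ' u' x z (Sum.inl α) (Sum.inl γ)) := by
  refine Finset.sum_congr rfl fun γ _ => ?_
  rw [h1, h1]
  simp only [shiftK]
  rw [show z + (N : ℤ) • t - unitVec γ + -((N : ℤ) • t) = z - unitVec γ from by abel, add_neg_cancel_right, add_neg_cancel_right]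

/-! ## §2 Summation by parts on the second leg -/

/-- NOT IN PRINT; OUR BOOKKEEPING.  **SUMMATION BY PARTS ON THE SECOND LEG** (`1 ≤ N`; the second-leg columns `z ↦ K x z a (inl γ)` summable): the sawtooth
gradient in the fibre direction `β` IS the `β`-component of the pure gauge `dλ_β`, whose other components vanish, so
`Σ'_z (1 − N·[z_β % N = N−1])·K x z a (inl β) = Σ'_z λ(z_β)·Σ_γ (K x (z − e_γ) a (inl γ) − K x z a (inl γ))` (Part 9's one-coordinate Abel lemma with the fibre
index in the role of the slot direction). -/
theorem tsum_sawGrad_leg₂_eq (hN : 1 ≤ N) {K : MKer (d + 1) (Fib d)} {x : Site (d + 1)} {a : Fib d}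
    (hK : ∀ γ : Fin (d + 1), Summable fun z : Site (d + 1) => K x z a (Sum.inl γ)) (β : Fin (d + 1)) :
    ∑' z : Site (d + 1), (1 - (N : ℝ) * (if z β % (N : ℤ) = (N : ℤ) - 1 then (1 : ℝ) else 0)) * K x z a (Sum.inl β)
      = ∑' z : Site (d + 1), (((z β % (N : ℤ)) : ℤ) : ℝ) * ∑ γ : Fin (d + 1), (K x (z - unitVec γ) a (Sum.inl γ) - K x z a (Sum.inl γ)) := by
  have h := tsum_sawGrad_mul_eq_tsum_saw_mul_div hN (fun γ z => K x z a (Sum.inl γ)) hK β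
  beta_reduce at h
  exact h

/-! ## §3 The second-leg Ward form with a passive weight -/

/-- [folklore] The rotated integrand — a bounded PASSIVE weight `P r u′ x` times the second leg's sawtooth times the pure-gauge divergence of the second leg — is
absolutely summable on the slot triple (bounded weights × finitely many shifted `LocStencil₂` slices). -/
theorem summable_leg₂_integrand {Y : Tab d} {C δ : ℝ} (hY : LocStencil₂ Y C δ) (hδ : 0 < δ) (hN : 1 ≤ N) {P : Site (d + 1) → Site (d + 1) → Site (d + 1) → ℝ} {B : ℝ} (hP : ∀ r u' x, |P r u' x| ≤ B)
    (κ κ' α β : Fin (d + 1)) (r : Site (d + 1)) :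
    Summable fun p : Site (d + 1) × (Site (d + 1) × Site (d + 1)) =>
      P r p.1 p.2.1 * ((((p.2.2 β % (N : ℤ)) : ℤ) : ℝ)
          * ∑ γ : Fin (d + 1), (Y κ r κ' p.1 p.2.1 (p.2.2 - unitVec γ) (Sum.inl α) (Sum.inl γ) - Y κ r κ' p.1 p.2.1 p.2.2 (Sum.inl α) (Sum.inl γ))) := by
  have hT : ∀ (r : Site (d + 1)) (γ : Fin (d + 1)), Summable fun p : Site (d + 1) × (Site (d + 1) × Site (d + 1)) =>
      Y κ r κ' p.1 p.2.1 p.2.2 (Sum.inl α) (Sum.inl γ) := fun r γ => summable_triple hY hδ κ r κ' _ _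
  have hTs : ∀ (r : Site (d + 1)) (γ : Fin (d + 1)), Summable fun p : Site (d + 1) × (Site (d + 1) × Site (d + 1)) =>
      Y κ r κ' p.1 p.2.1 (p.2.2 - unitVec γ) (Sum.inl α) (Sum.inl γ) := by
    intro r γ
    have hinj : Function.Injective (fun p : Site (d + 1) × (Site (d + 1) × Site (d + 1)) => (p.1, (p.2.1, p.2.2 - unitVec γ))) := by
      rintro ⟨u, x, z⟩ ⟨u₁, x₁, z₁⟩ h
      simp only [Prod.mk.injEq, sub_left_inj] at h
      obtain ⟨rfl, rfl, rfl⟩ := h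
      rfl
    exact (hT r γ).comp_injective hinj
  have hD : Summable fun p : Site (d + 1) × (Site (d + 1) × Site (d + 1)) =>
      ∑ γ : Fin (d + 1), (Y κ r κ' p.1 p.2.1 (p.2.2 - unitVec γ) (Sum.inl α) (Sum.inl γ) - Y κ r κ' p.1 p.2.1 p.2.2 (Sum.inl α) (Sum.inl γ)) :=
    summable_sum fun γ _ => (hTs r γ).sub (hT r γ)
  exact summable_bdd_mul (summable_bdd_mul hD (fun p => abs_saw_le hN (p.2.2 β))) (fun p => hP r p.1 p.2.1)

/-- [folklore] STEPS 1–2 — SUMMATION BY PARTS ON THE INNERMOST LEG, THEN THE FUBINI ROTATION (one slot `r`, passive weight `P r u′ x`). -/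
theorem leg₂_abel_rotate (hN : 1 ≤ N) {Y : Tab d} {C δ : ℝ} (hY : LocStencil₂ Y C δ) (hδ : 0 < δ) {P : Site (d + 1) → Site (d + 1) → Site (d + 1) → ℝ} {B : ℝ} (hP : ∀ r u' x, |P r u' x| ≤ B) (κ κ' α β : Fin (d + 1)) (r : Site (d + 1)) :
    (∑' u' : Site (d + 1), ∑' x : Site (d + 1), ∑' z : Site (d + 1),
        P r u' x * (1 - (N : ℝ) * (if z β % (N : ℤ) = (N : ℤ) - 1 then (1 : ℝ) else 0)) * Y κ r κ' u' x z (Sum.inl α) (Sum.inl β))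
      = ∑' z : Site (d + 1), ∑' u' : Site (d + 1), ∑' x : Site (d + 1),
          P r u' x * (((((z) β % (N : ℤ)) : ℤ) : ℝ) * ∑ γ : Fin (d + 1), (Y κ r κ' u' x (z - unitVec γ) (Sum.inl α) (Sum.inl γ) - Y κ r κ' u' x (z) (Sum.inl α) (Sum.inl γ))) := by
  have eA : ∀ (u' x : Site (d + 1)), (∑' z : Site (d + 1), P r u' x * (1 - (N : ℝ) * (if z β % (N : ℤ) = (N : ℤ) - 1 then (1 : ℝ) else 0)) * Y κ r κ' u' x z (Sum.inl α) (Sum.inl β))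
      = ∑' z : Site (d + 1), P r u' x * (((((z) β % (N : ℤ)) : ℤ) : ℝ) * ∑ γ : Fin (d + 1), (Y κ r κ' u' x (z - unitVec γ) (Sum.inl α) (Sum.inl γ) - Y κ r κ' u' x (z) (Sum.inl α) (Sum.inl γ))) := by
    intro u' x
    have hK : ∀ γ : Fin (d + 1), Summable fun z : Site (d + 1) => Y κ r κ' u' x z (Sum.inl α) (Sum.inl γ) :=
      fun γ => (summable_prod_of_biLoc (hY κ r κ' u') hδ (Sum.inl α) (Sum.inl γ)).prod_factor x
    simp_rw [mul_assoc]
    rw [tsum_mul_left, tsum_mul_left, tsum_sawGrad_leg₂_eq hN hK β]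
  rw [tsum_congr fun u' => tsum_congr fun x => eA u' x]
  exact tsum3_rotate (G := fun u' x z => P r u' x * (((((z) β % (N : ℤ)) : ℤ) : ℝ) * ∑ γ : Fin (d + 1), (Y κ r κ' u' x (z - unitVec γ) (Sum.inl α) (Sum.inl γ) - Y κ r κ' u' x (z) (Sum.inl α) (Sum.inl γ)))) (summable_leg₂_integrand hY hδ hN hP κ κ' α β r)

/-- [folklore] STEP 3 — THE CELL–SLOT EXCHANGE between the first background slot and the second leg (`SawtoothSlotCalculus.sum_box_tsum_exchange`; jointly `N`-periodic
by the passive weight's periodicity `hPt`, the sawtooth's, and `legDiv₂_translate`; summable sections by `summable_rotate` ∕ `summable_triple_leg₂`). -/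
theorem leg₂_exchange [NeZero N] {Y : Tab d} {C δ : ℝ} (hY : LocStencil₂ Y C δ) (hδ : 0 < δ)
    (h1 : ∀ κ u κ' u' (t x z : Site (d + 1)) (α β : Fin (d + 1)),
      Y κ (u + (N : ℤ) • t) κ' (u' + (N : ℤ) • t) x z (Sum.inl α) (Sum.inl β) = shiftK (-((N : ℤ) • t)) (Y κ u κ' u') x z (Sum.inl α) (Sum.inl β))
    {P : Site (d + 1) → Site (d + 1) → Site (d + 1) → ℝ} {B : ℝ} (hP : ∀ r u' x, |P r u' x| ≤ B) (hPt : ∀ r u' x t : Site (d + 1), P (r + (N : ℤ) • t) (u' + (N : ℤ) • t) (x + (N : ℤ) • t) = P r u' x)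
    (κ κ' α β : Fin (d + 1)) :
    ∑ rr ∈ box (d + 1) N, ∑' z : Site (d + 1), ∑' u' : Site (d + 1), ∑' x : Site (d + 1),
        P (toSite rr) u' x * (((((z) β % (N : ℤ)) : ℤ) : ℝ) * ∑ γ : Fin (d + 1), (Y κ (toSite rr) κ' u' x (z - unitVec γ) (Sum.inl α) (Sum.inl γ) - Y κ (toSite rr) κ' u' x (z) (Sum.inl α) (Sum.inl γ)))
      = ∑ zz ∈ box (d + 1) N, ∑' r : Site (d + 1), ∑' u' : Site (d + 1), ∑' x : Site (d + 1),
          P r u' x * (((((toSite zz) β % (N : ℤ)) : ℤ) : ℝ) * ∑ γ : Fin (d + 1), (Y κ r κ' u' x (toSite zz - unitVec γ) (Sum.inl α) (Sum.inl γ) - Y κ r κ' u' x (toSite zz) (Sum.inl α) (Sum.inl γ))) := by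
  have hN : 1 ≤ N := Nat.one_le_iff_ne_zero.mpr (NeZero.ne N)
  have hper : ∀ r z t : Site (d + 1),
      (∑' u' : Site (d + 1), ∑' x : Site (d + 1), P (r + (N : ℤ) • t) u' x
        * (((((z + (N : ℤ) • t) β % (N : ℤ)) : ℤ) : ℝ)
          * ∑ γ : Fin (d + 1), (Y κ (r + (N : ℤ) • t) κ' u' x (z + (N : ℤ) • t - unitVec γ) (Sum.inl α) (Sum.inl γ)
            - Y κ (r + (N : ℤ) • t) κ' u' x (z + (N : ℤ) • t) (Sum.inl α) (Sum.inl γ))))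
      = ∑' u' : Site (d + 1), ∑' x : Site (d + 1), P r u' x * (((((z) β % (N : ℤ)) : ℤ) : ℝ) * ∑ γ : Fin (d + 1), (Y κ r κ' u' x (z - unitVec γ) (Sum.inl α) (Sum.inl γ) - Y κ r κ' u' x (z) (Sum.inl α) (Sum.inl γ))) := by
    intro r z t
    rw [← tsum_add_shift (fun u' : Site (d + 1) => ∑' x : Site (d + 1), P (r + (N : ℤ) • t) u' x
        * (((((z + (N : ℤ) • t) β % (N : ℤ)) : ℤ) : ℝ)
          * ∑ γ : Fin (d + 1), (Y κ (r + (N : ℤ) • t) κ' u' x (z + (N : ℤ) • t - unitVec γ) (Sum.inl α) (Sum.inl γ)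
            - Y κ (r + (N : ℤ) • t) κ' u' x (z + (N : ℤ) • t) (Sum.inl α) (Sum.inl γ)))) ((N : ℤ) • t)]
    refine tsum_congr fun u' => ?_
    rw [← tsum_add_shift (fun x : Site (d + 1) => P (r + (N : ℤ) • t) (u' + (N : ℤ) • t) x
        * (((((z + (N : ℤ) • t) β % (N : ℤ)) : ℤ) : ℝ)
          * ∑ γ : Fin (d + 1), (Y κ (r + (N : ℤ) • t) κ' (u' + (N : ℤ) • t) x (z + (N : ℤ) • t - unitVec γ) (Sum.inl α) (Sum.inl γ)
            - Y κ (r + (N : ℤ) • t) κ' (u' + (N : ℤ) • t) x (z + (N : ℤ) • t) (Sum.inl α) (Sum.inl γ)))) ((N : ℤ) • t)]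
    refine tsum_congr fun x => ?_
    rw [legDiv₂_translate h1, hPt, emod_add_zsmul_apply]
  have hS1 : ∀ rr ∈ box (d + 1) N, Summable fun z : Site (d + 1) => ∑' u' : Site (d + 1), ∑' x : Site (d + 1),
      P (toSite rr) u' x * (((((z) β % (N : ℤ)) : ℤ) : ℝ) * ∑ γ : Fin (d + 1), (Y κ (toSite rr) κ' u' x (z - unitVec γ) (Sum.inl α) (Sum.inl γ) - Y κ (toSite rr) κ' u' x (z) (Sum.inl α) (Sum.inl γ))) :=
    fun rr _ => summable_rotate (G := fun u' x z => P (toSite rr) u' x * (((((z) β % (N : ℤ)) : ℤ) : ℝ) * ∑ γ : Fin (d + 1), (Y κ (toSite rr) κ' u' x (z - unitVec γ) (Sum.inl α) (Sum.inl γ) - Y κ (toSite rr) κ' u' x (z) (Sum.inl α) (Sum.inl γ))))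
      (summable_leg₂_integrand hY hδ hN hP κ κ' α β (toSite rr))
  have hS2 : ∀ zz ∈ box (d + 1) N, Summable fun r : Site (d + 1) => ∑' u' : Site (d + 1), ∑' x : Site (d + 1),
      P r u' x * (((((toSite zz) β % (N : ℤ)) : ℤ) : ℝ) * ∑ γ : Fin (d + 1), (Y κ r κ' u' x (toSite zz - unitVec γ) (Sum.inl α) (Sum.inl γ) - Y κ r κ' u' x (toSite zz) (Sum.inl α) (Sum.inl γ))) := by
    intro zz _
    have hL : ∀ (z₀ : Site (d + 1)) (γ : Fin (d + 1)), Summable fun p : Site (d + 1) × (Site (d + 1) × Site (d + 1)) =>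
        Y κ p.1 κ' p.2.1 p.2.2 z₀ (Sum.inl α) (Sum.inl γ) := fun z₀ γ => summable_triple_leg₂ hY hδ κ κ' z₀ _ _
    have hD : Summable fun p : Site (d + 1) × (Site (d + 1) × Site (d + 1)) =>
        ∑ γ : Fin (d + 1), (Y κ p.1 κ' p.2.1 p.2.2 (toSite zz - unitVec γ) (Sum.inl α) (Sum.inl γ) - Y κ p.1 κ' p.2.1 p.2.2 (toSite zz) (Sum.inl α) (Sum.inl γ)) :=
      summable_sum fun γ _ => (hL _ γ).sub (hL _ γ)
    have hF : Summable fun p : Site (d + 1) × (Site (d + 1) × Site (d + 1)) =>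
        P p.1 p.2.1 p.2.2 * (((((toSite zz) β % (N : ℤ)) : ℤ) : ℝ)
            * ∑ γ : Fin (d + 1), (Y κ p.1 κ' p.2.1 p.2.2 (toSite zz - unitVec γ) (Sum.inl α) (Sum.inl γ)
              - Y κ p.1 κ' p.2.1 p.2.2 (toSite zz) (Sum.inl α) (Sum.inl γ))) :=
      summable_bdd_mul ((hD.mul_left _)) (fun p => hP p.1 p.2.1 p.2.2)
    exact hF.prod.congr fun r => (hF.prod_factor r).tsum_prod
  have hx := sum_box_tsum_exchange (N := N) (fun r z : Site (d + 1) => ∑' u' : Site (d + 1), ∑' x : Site (d + 1),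
      P r u' x * (((((z) β % (N : ℤ)) : ℤ) : ℝ) * ∑ γ : Fin (d + 1), (Y κ r κ' u' x (z - unitVec γ) (Sum.inl α) (Sum.inl γ) - Y κ r κ' u' x (z) (Sum.inl α) (Sum.inl γ)))) hper hS1 hS2
  exact hx

/-- NOT IN PRINT; OUR BOOKKEEPING.  **THE SECOND-LEG WARD FORM WITH A PASSIVE WEIGHT** (`1 ≤ N`, `LocStencil₂ Y C δ`, `0 < δ`, ff block block-covariant; `P r u′ x`
bounded and jointly `N`-periodic — e.g. the sawtooth gradient on ANY of the other three slots, or a product of them):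
`Σ_{r∈box} Σ'_{u′xz} P (toSite r) u′ x·(1 − N·[z_β % N = N−1])·Y κ (toSite r) κ′ u′ x z (inl α)(inl β)
 = Σ_{z₀∈box} (z₀)_β·Σ'_r Σ'_{u′} Σ'_x P r u′ x·Σ_γ (Y κ r κ′ u′ x (toSite z₀ − e_γ) (inl α)(inl γ) − Y κ r κ′ u′ x (toSite z₀) (inl α)(inl γ))` — the sawtooth gradient
on the SECOND LEG becomes the block sawtooth on ONE CELL of second-leg sites against the pure-gauge divergence of that leg; every other weight rides along. -/
theorem sum_box_weighted_sawGrad_leg₂_eq (hN : 1 ≤ N) {Y : Tab d} {C δ : ℝ} (hY : LocStencil₂ Y C δ) (hδ : 0 < δ)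
    (h1 : ∀ κ u κ' u' (t x z : Site (d + 1)) (α β : Fin (d + 1)),
      Y κ (u + (N : ℤ) • t) κ' (u' + (N : ℤ) • t) x z (Sum.inl α) (Sum.inl β) = shiftK (-((N : ℤ) • t)) (Y κ u κ' u') x z (Sum.inl α) (Sum.inl β))
    {P : Site (d + 1) → Site (d + 1) → Site (d + 1) → ℝ} {B : ℝ} (hP : ∀ r u' x, |P r u' x| ≤ B) (hPt : ∀ r u' x t : Site (d + 1), P (r + (N : ℤ) • t) (u' + (N : ℤ) • t) (x + (N : ℤ) • t) = P r u' x)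
    (κ κ' α β : Fin (d + 1)) :
    ∑ rr ∈ box (d + 1) N, ∑' u' : Site (d + 1), ∑' x : Site (d + 1), ∑' z : Site (d + 1),
        P (toSite rr) u' x * (1 - (N : ℝ) * (if z β % (N : ℤ) = (N : ℤ) - 1 then (1 : ℝ) else 0)) * Y κ (toSite rr) κ' u' x z (Sum.inl α) (Sum.inl β)
      = ∑ zz ∈ box (d + 1) N, ((zz β : ℕ) : ℝ) * ∑' r : Site (d + 1), ∑' u' : Site (d + 1), ∑' x : Site (d + 1),
          P r u' x * ∑ γ : Fin (d + 1), (Y κ r κ' u' x (toSite zz - unitVec γ) (Sum.inl α) (Sum.inl γ) - Y κ r κ' u' x (toSite zz) (Sum.inl α) (Sum.inl γ)) := by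
  haveI : NeZero N := ⟨by omega⟩
  rw [Finset.sum_congr rfl fun rr _ => leg₂_abel_rotate hN hY hδ hP κ κ' α β (toSite rr), leg₂_exchange hY hδ h1 hP hPt κ κ' α β]
  refine Finset.sum_congr rfl fun zz hzz => ?_
  rw [← tsum_mul_left]
  refine tsum_congr fun r => ?_
  rw [← tsum_mul_left]
  refine tsum_congr fun u' => ?_
  rw [← tsum_mul_left]
  refine tsum_congr fun x => ?_
  rw [toSite_emod_of_mem_box hzz, Int.cast_natCast]
  ring

/-! ## §4 The pure-gauge sectors with the second leg gauged: the leg pair `{2,3}` and the mixed pairs `{0,3}`, `{1,3}` -/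

/-- NOT IN PRINT; OUR BOOKKEEPING.  **THE LEG-PAIR SECTOR `Sector_{23}` OF PART 1 IN WARD-READY FORM** (Part 1's literal sector for `S = {2,3}`, directions `![κ, κ′, α, β]`, legs
`(inl α, inl β)` — the four-face weight on a field leg reads the leg's own fibre direction): `Sector_{23}(Y) = Σ_{z₀∈box N} (z₀)_β·Σ'_r Σ'_{u′} Σ'_x (1 − N·[x_α % N = N−1])·Σ_γ (Y κ r κ′ u′ x (toSite z₀ − e_γ) (inl α)(inl γ) − Y κ r κ′ u′ x (toSite z₀) (inl α)(inl γ))` (§3 with the passive weight on the first leg). -/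
theorem sector23_eq_sum_saw_legDiv (hN : 1 ≤ N) {Y : Tab d} {C δ : ℝ} (hY : LocStencil₂ Y C δ) (hδ : 0 < δ)
    (h1 : ∀ κ u κ' u' (t x z : Site (d + 1)) (α β : Fin (d + 1)),
      Y κ (u + (N : ℤ) • t) κ' (u' + (N : ℤ) • t) x z (Sum.inl α) (Sum.inl β) = shiftK (-((N : ℤ) • t)) (Y κ u κ' u') x z (Sum.inl α) (Sum.inl β))
    (κ κ' α β : Fin (d + 1)) :
    ∑ rr ∈ box (d + 1) N, ∑' u' : Site (d + 1), ∑' x : Site (d + 1), ∑' z : Site (d + 1),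
        (∏ s ∈ ({2, 3} : Finset (Fin 4)), (1 - (N : ℝ) * (if (![toSite rr, u', x, z] : Fin 4 → Site (d + 1)) s
            ((![κ, κ', α, β] : Fin 4 → Fin (d + 1)) s) % (N : ℤ) = (N : ℤ) - 1 then (1 : ℝ) else 0)))
          * Y κ (toSite rr) κ' u' x z (Sum.inl α) (Sum.inl β)
      = ∑ zz ∈ box (d + 1) N, ((zz β : ℕ) : ℝ) * ∑' r : Site (d + 1), ∑' u' : Site (d + 1), ∑' x : Site (d + 1),
          (1 - (N : ℝ) * (if x α % (N : ℤ) = (N : ℤ) - 1 then (1 : ℝ) else 0))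
            * ∑ γ : Fin (d + 1), (Y κ r κ' u' x (toSite zz - unitVec γ) (Sum.inl α) (Sum.inl γ) - Y κ r κ' u' x (toSite zz) (Sum.inl α) (Sum.inl γ)) := by
  have hne : (2 : Fin 4) ≠ 3 := by decide
  have eP : ∀ (rr : Fin (d + 1) → ℕ) (u' x z : Site (d + 1)),
      (∏ s ∈ ({2, 3} : Finset (Fin 4)), (1 - (N : ℝ) * (if (![toSite rr, u', x, z] : Fin 4 → Site (d + 1)) s
          ((![κ, κ', α, β] : Fin 4 → Fin (d + 1)) s) % (N : ℤ) = (N : ℤ) - 1 then (1 : ℝ) else 0)))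
        = (1 - (N : ℝ) * (if x α % (N : ℤ) = (N : ℤ) - 1 then (1 : ℝ) else 0)) * (1 - (N : ℝ) * (if z β % (N : ℤ) = (N : ℤ) - 1 then (1 : ℝ) else 0)) := by
    intro rr u' x z
    rw [Finset.prod_pair hne]
    rfl
  simp_rw [eP]
  exact sum_box_weighted_sawGrad_leg₂_eq hN hY hδ h1 (P := fun r u' x => (1 - (N : ℝ) * (if x α % (N : ℤ) = (N : ℤ) - 1 then (1 : ℝ) else 0)))
    (fun r u' x => abs_sawGrad_le N _) (fun r u' x t => by rw [emod_add_zsmul_apply]) κ κ' α β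

/-- NOT IN PRINT; OUR BOOKKEEPING.  **THE MIXED SLOT–LEG SECTOR `Sector_{03}` IN WARD-READY FORM** (first background slot × second leg; live on the swap class `(κ,a;a,κ)` of Part 2):
`Sector_{03}(Y) = Σ_{z₀∈box N} (z₀)_β·Σ'_r Σ'_{u′} Σ'_x (1 − N·[r_κ % N = N−1])·Σ_γ (Y κ r κ′ u′ x (toSite z₀ − e_γ) (inl α)(inl γ) − Y κ r κ′ u′ x (toSite z₀) (inl α)(inl γ))` (§3 with the passive weight on the first background slot, which runs over the lattice after the exchange). -/
theorem sector03_eq_sum_saw_legDiv (hN : 1 ≤ N) {Y : Tab d} {C δ : ℝ} (hY : LocStencil₂ Y C δ) (hδ : 0 < δ)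
    (h1 : ∀ κ u κ' u' (t x z : Site (d + 1)) (α β : Fin (d + 1)),
      Y κ (u + (N : ℤ) • t) κ' (u' + (N : ℤ) • t) x z (Sum.inl α) (Sum.inl β) = shiftK (-((N : ℤ) • t)) (Y κ u κ' u') x z (Sum.inl α) (Sum.inl β))
    (κ κ' α β : Fin (d + 1)) :
    ∑ rr ∈ box (d + 1) N, ∑' u' : Site (d + 1), ∑' x : Site (d + 1), ∑' z : Site (d + 1),
        (∏ s ∈ ({0, 3} : Finset (Fin 4)), (1 - (N : ℝ) * (if (![toSite rr, u', x, z] : Fin 4 → Site (d + 1)) s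
            ((![κ, κ', α, β] : Fin 4 → Fin (d + 1)) s) % (N : ℤ) = (N : ℤ) - 1 then (1 : ℝ) else 0)))
          * Y κ (toSite rr) κ' u' x z (Sum.inl α) (Sum.inl β)
      = ∑ zz ∈ box (d + 1) N, ((zz β : ℕ) : ℝ) * ∑' r : Site (d + 1), ∑' u' : Site (d + 1), ∑' x : Site (d + 1),
          (1 - (N : ℝ) * (if r κ % (N : ℤ) = (N : ℤ) - 1 then (1 : ℝ) else 0))
            * ∑ γ : Fin (d + 1), (Y κ r κ' u' x (toSite zz - unitVec γ) (Sum.inl α) (Sum.inl γ) - Y κ r κ' u' x (toSite zz) (Sum.inl α) (Sum.inl γ)) := by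
  have hne : (0 : Fin 4) ≠ 3 := by decide
  have eP : ∀ (rr : Fin (d + 1) → ℕ) (u' x z : Site (d + 1)),
      (∏ s ∈ ({0, 3} : Finset (Fin 4)), (1 - (N : ℝ) * (if (![toSite rr, u', x, z] : Fin 4 → Site (d + 1)) s
          ((![κ, κ', α, β] : Fin 4 → Fin (d + 1)) s) % (N : ℤ) = (N : ℤ) - 1 then (1 : ℝ) else 0)))
        = (1 - (N : ℝ) * (if toSite rr κ % (N : ℤ) = (N : ℤ) - 1 then (1 : ℝ) else 0)) * (1 - (N : ℝ) * (if z β % (N : ℤ) = (N : ℤ) - 1 then (1 : ℝ) else 0)) := by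
    intro rr u' x z
    rw [Finset.prod_pair hne]
    rfl
  simp_rw [eP]
  exact sum_box_weighted_sawGrad_leg₂_eq hN hY hδ h1 (P := fun r u' x => (1 - (N : ℝ) * (if r κ % (N : ℤ) = (N : ℤ) - 1 then (1 : ℝ) else 0)))
    (fun r u' x => abs_sawGrad_le N _) (fun r u' x t => by rw [emod_add_zsmul_apply]) κ κ' α β

/-- NOT IN PRINT; OUR BOOKKEEPING.  **THE MIXED SLOT–LEG SECTOR `Sector_{13}` IN WARD-READY FORM** (second background slot × second leg; live on the cross class `(κ,a;κ,a)` of Part 2):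
`Sector_{13}(Y) = Σ_{z₀∈box N} (z₀)_β·Σ'_r Σ'_{u′} Σ'_x (1 − N·[u′_{κ′} % N = N−1])·Σ_γ (Y κ r κ′ u′ x (toSite z₀ − e_γ) (inl α)(inl γ) − Y κ r κ′ u′ x (toSite z₀) (inl α)(inl γ))`. -/
theorem sector13_eq_sum_saw_legDiv (hN : 1 ≤ N) {Y : Tab d} {C δ : ℝ} (hY : LocStencil₂ Y C δ) (hδ : 0 < δ)
    (h1 : ∀ κ u κ' u' (t x z : Site (d + 1)) (α β : Fin (d + 1)),
      Y κ (u + (N : ℤ) • t) κ' (u' + (N : ℤ) • t) x z (Sum.inl α) (Sum.inl β) = shiftK (-((N : ℤ) • t)) (Y κ u κ' u') x z (Sum.inl α) (Sum.inl β))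
    (κ κ' α β : Fin (d + 1)) :
    ∑ rr ∈ box (d + 1) N, ∑' u' : Site (d + 1), ∑' x : Site (d + 1), ∑' z : Site (d + 1),
        (∏ s ∈ ({1, 3} : Finset (Fin 4)), (1 - (N : ℝ) * (if (![toSite rr, u', x, z] : Fin 4 → Site (d + 1)) s
            ((![κ, κ', α, β] : Fin 4 → Fin (d + 1)) s) % (N : ℤ) = (N : ℤ) - 1 then (1 : ℝ) else 0)))
          * Y κ (toSite rr) κ' u' x z (Sum.inl α) (Sum.inl β)
      = ∑ zz ∈ box (d + 1) N, ((zz β : ℕ) : ℝ) * ∑' r : Site (d + 1), ∑' u' : Site (d + 1), ∑' x : Site (d + 1),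
          (1 - (N : ℝ) * (if u' κ' % (N : ℤ) = (N : ℤ) - 1 then (1 : ℝ) else 0))
            * ∑ γ : Fin (d + 1), (Y κ r κ' u' x (toSite zz - unitVec γ) (Sum.inl α) (Sum.inl γ) - Y κ r κ' u' x (toSite zz) (Sum.inl α) (Sum.inl γ)) := by
  have hne : (1 : Fin 4) ≠ 3 := by decide
  have eP : ∀ (rr : Fin (d + 1) → ℕ) (u' x z : Site (d + 1)),
      (∏ s ∈ ({1, 3} : Finset (Fin 4)), (1 - (N : ℝ) * (if (![toSite rr, u', x, z] : Fin 4 → Site (d + 1)) s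
          ((![κ, κ', α, β] : Fin 4 → Fin (d + 1)) s) % (N : ℤ) = (N : ℤ) - 1 then (1 : ℝ) else 0)))
        = (1 - (N : ℝ) * (if u' κ' % (N : ℤ) = (N : ℤ) - 1 then (1 : ℝ) else 0)) * (1 - (N : ℝ) * (if z β % (N : ℤ) = (N : ℤ) - 1 then (1 : ℝ) else 0)) := by
    intro rr u' x z
    rw [Finset.prod_pair hne]
    rfl
  simp_rw [eP]
  exact sum_box_weighted_sawGrad_leg₂_eq hN hY hδ h1 (P := fun r u' x => (1 - (N : ℝ) * (if u' κ' % (N : ℤ) = (N : ℤ) - 1 then (1 : ℝ) else 0)))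
    (fun r u' x => abs_sawGrad_le N _) (fun r u' x t => by rw [emod_add_zsmul_apply]) κ κ' α β

end Summit.QuantumFields.BalabanUV.Beta.GAN24.LegPairSectorWardForm

end
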